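import Summits.AtomisticToContinuum.HydrodynamicLimit.Theorems.CellForecastPressureDecay.Negative.WithoutOrthogonality

/-!
# `CellForecastPressureDecay`, small model `n = 1`: a lone particle's forecast is free flight and the
# crux functional is the static exponential moment `∫ M e^{2cg}` at every horizon

Negative-side infrastructure for the crux `AntiMazurCoboundaries.CellForecastPressureDecay`
(stmt-AtomisticToContinuum-13915), from `Cruxes/CellForecastPressureDecay/Disproof.lean`
(seat refuter-cdisprove-stmt-AtomisticToContinuum-13915-0):

* § 3: a hard-sphere trajectory of `≤ 1` particle keeps its velocities (structure fields `free`, `flow_zero`: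
  no pair, no collision time), so the isolated evolution of a one-particle range cluster — on and off the good
  set (off it the cluster is frozen) — leaves the velocity of the particle unchanged:
  `vel_localClusterState_of_card_le_one`; for `n = 1` the crux's window average is `g(v)` at every horizon
  `T` (`windowAverage_one`).
* § 4: the one-particle cell law is `L⁻³ 1_{[0,L]³}(x) M(v) dx dv` (`cellLaw_one_eq`, `canonicalPartition_one`)
  and its exponential moments are `∫⁻ F(v) dP_{1,L} = ∫ M F dv` (`lintegral_cellLaw_one`).
Consequence (in `Negative/PerParticle.lean`): the decay asked by the crux is entirely an interaction effect,
and the per-volume slack `e^{δL³}` cannot be replaced by `e^{δ n}`.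
-/

open MeasureTheory Set Metric Filter ProbabilityTheory
open scoped ENNReal InnerProductSpace
open Literature.Analysis.FluidPDE Literature.MathematicalPhysics.KineticTheory

namespace Summit.AtomisticToContinuum.HydrodynamicLimit.Theorems

noncomputable section

namespace CellForecastPressureDecay
/-! ## § 3 A lone particle: a 1-cluster forecast is free flight -/

section LoneParticle

variable {d : Type*} [Fintype d] {X : Type*} [MeasureSpace X] [TopologicalSpace X]
  {G : Geometry d X} {ε : ℝ}

/-- A hard-sphere trajectory of at most one particle keeps its velocities (there is no pair, hence
no collision time, hence free flight by the `free` field). [folklore] -/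
theorem vel_flow_eq_of_le_one {k : ℕ} (hk : k ≤ 1) (Φ : HardSphereFlow G ε k) {z : Config k d X}
    (hz : z ∈ Φ.good) (t : ℝ) (m : Fin k) : (Φ.flow t z m).2 = (z m).2 := by
  have htraj := Φ.isTrajectory z hz
  have hno : ∀ τ, τ ∉ collisionTimes G ε (fun s => Φ.flow s z) := by
    intro τ hτ
    obtain ⟨i, j, hij, -⟩ := mem_collisionTimes.1 hτ
    have hi := i.isLt
    have hj := j.isLt
    exact hij (Fin.ext (by omega))
  rcases le_total 0 t with ht | ht
  · have h := congrFun (htraj.free 0 t ht fun τ _ => hno τ) m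
    rw [h, freeFlight_apply, Φ.flow_zero z hz]
  · have h := congrFun (htraj.free t 0 ht fun τ _ => hno τ) m
    rw [Φ.flow_zero z hz] at h
    rw [h, freeFlight_apply]

variable {N : ℕ}

/-- The isolated evolution of a cluster with at most one particle does not change velocities
(on and off the good set: off it the cluster is frozen). [folklore] -/
theorem vel_clusterStateIn_of_card_le_one (Ψ : (k : ℕ) → HardSphereFlow G ε k) {S : Finset (Fin N)}
    (hS : S.card ≤ 1) (m : Fin S.card) (t : ℝ) (z : Config N d X) :
    (clusterStateIn Ψ S m t z).2 = (Config.restrictTo S z m).2 := by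
  by_cases hz : Config.restrictTo S z ∈ (Ψ S.card).good
  · rw [clusterStateIn_of_mem_good Ψ m t hz]
    exact vel_flow_eq_of_le_one hS (Ψ S.card) hz t m
  · rw [clusterStateIn_of_not_mem_good Ψ m t hz, Config.restrictTo_apply]

/-- **A lone particle flies freely**: if the range cluster of `i` is `{i}`, the forecast velocity of
`i` is its initial velocity at all times. [folklore] -/
theorem vel_localClusterState_of_card_le_one (Ψ : (k : ℕ) → HardSphereFlow G ε k) {R : ℝ}
    {z : Config N d X} {i : Fin N} (h : (rangeCluster G R z i).card ≤ 1) (t : ℝ) :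
    (localClusterState Ψ R t z i).2 = (z i).2 := by
  rw [localClusterState, vel_clusterStateIn_of_card_le_one Ψ h, Config.restrictTo_clusterIndex]

end LoneParticle

/-- For `n = 1` the crux's window average is `g(v)`: the single particle is its own cluster. [folklore] -/
theorem windowAverage_one {σ : ℝ} (Ψ : (k : ℕ) → HardSphereFlow (Euclidean.geometry (Fin 3)) σ k)
    (R : ℝ) {T : ℝ} (hT : T ≠ 0) (g : V3 → ℝ) (c : ℝ) (z : Config 1 (Fin 3) V3) :
    2 * c * ∑ i : Fin 1, T⁻¹ * ∫ t in (0 : ℝ)..T, g (localClusterState Ψ R t z i).2 =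
      2 * c * g (z 0).2 := by
  have hcard : ∀ i : Fin 1, (rangeCluster (Euclidean.geometry (Fin 3)) R z i).card ≤ 1 :=
    fun i => (Finset.card_le_univ _).trans (by simp)
  simp only [vel_localClusterState_of_card_le_one Ψ (hcard _), intervalIntegral.integral_const,
    sub_zero, smul_eq_mul, Fin.sum_univ_one, inv_mul_cancel_left₀ hT]

/-! ## § 4 The one-particle cell law and its exponential moments -/

/-- One particle: the hard-sphere domain is everything. [folklore] -/
theorem hardSphereDomain_one (σ : ℝ) :
    hardSphereDomain (Euclidean.geometry (Fin 3)) 1 σ = (univ : Set (Config 1 (Fin 3) V3)) :=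
  eq_univ_of_forall fun _ => mem_hardSphereDomain.2 fun i j hij => absurd (Subsingleton.elim i j) hij

/-- `cellRef L` is measurable. [folklore] -/
theorem measurable_cellRef (L : ℝ) : Measurable (cellRef L) :=
  ((measurable_const.indicator (measurableSet_cellCube L)).comp measurable_fst).mul
    (continuous_globalMaxwellian.measurable.comp measurable_snd)

/-- `∫ cellRef L = L³`. [folklore] -/
theorem integral_cellRef {L : ℝ} (hL : 0 ≤ L) : ∫ p : V3 × V3, cellRef L p = L ^ 3 := by
  have h3 : ∫ p : V3 × V3, cellRef L p =
      (∫ x : V3, (cellCube L).indicator (fun _ => (1 : ℝ)) x) * ∫ v : V3, globalMaxwellian v := by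
    rw [Measure.volume_eq_prod, ← integral_prod_mul]
    rfl
  rw [h3, integral_indicator_const _ (measurableSet_cellCube L), smul_eq_mul, mul_one, Measure.real,
    volume_cellCube, show (∫ v : V3, globalMaxwellian v) = 1 from integral_globalMaxwellian_eq_one_holds,
    mul_one, ← ENNReal.ofReal_pow hL, ENNReal.toReal_ofReal (pow_nonneg hL 3)]

/-- One particle: the partition function is `L³`. [folklore] -/
theorem canonicalPartition_one (σ : ℝ) {L : ℝ} (hL : 0 ≤ L) :
    canonicalPartition (Euclidean.geometry (Fin 3)) σ 1 (cellRef L) = L ^ 3 := by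
  rw [canonicalPartition, hardSphereDomain_one, indicator_univ]
  have h1 : (tensorPow 1 (cellRef L) : Config 1 (Fin 3) V3 → ℝ) =
      fun z : Config 1 (Fin 3) V3 => cellRef L (z 0) := by
    funext z
    simp [tensorPow]
  rw [h1, ← integral_cellRef hL,
    ← (volume_preserving_funUnique (Fin 1) (V3 × V3)).integral_comp' (cellRef L)]
  rfl

/-- One particle: the cell law is Lebesgue measure with density `L⁻³ 1_{[0,L]³}(x) M(v)`. [folklore] -/
theorem cellLaw_one_eq (σ : ℝ) {L : ℝ} (hL : 0 < L)
    (Φ : HardSphereFlow (Euclidean.geometry (Fin 3)) σ 1) :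
    particleLaw Φ (canonicalDensity (Euclidean.geometry (Fin 3)) σ 1 (cellRef L)) =
      volume.withDensity
        (fun z : Config 1 (Fin 3) V3 => ENNReal.ofReal ((L ^ 3)⁻¹ * cellRef L (z 0))) := by
  rw [particleLaw_eq, liouville_eq, hardSphereDomain_one, Measure.restrict_univ]
  congr 1
  funext z
  rw [canonicalDensity, canonicalPartition_one σ hL.le, hardSphereDomain_one, indicator_univ]
  simp [tensorPow]

/-- **Exponential moments of the one-particle cell law**: for measurable `F ≥ 0` with `M·F`
integrable, `∫⁻ F(v) dP_{1,L} = ∫ M F dv` — the position is uniform on the cube and integrates out. [folklore] -/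
theorem lintegral_cellLaw_one (σ : ℝ) {L : ℝ} (hL : 0 < L)
    (Φ : HardSphereFlow (Euclidean.geometry (Fin 3)) σ 1) {F : V3 → ℝ} (hFm : Measurable F)
    (hF0 : ∀ v, 0 ≤ F v) (hFi : Integrable fun v => globalMaxwellian v * F v) :
    ∫⁻ z, ENNReal.ofReal (F (z 0).2)
        ∂(particleLaw Φ (canonicalDensity (Euclidean.geometry (Fin 3)) σ 1 (cellRef L))) =
      ENNReal.ofReal (∫ v, globalMaxwellian v * F v) := by
  have hL3 : 0 < L ^ 3 := pow_pos hL 3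
  have hdens : Measurable fun z : Config 1 (Fin 3) V3 =>
      ENNReal.ofReal ((L ^ 3)⁻¹ * cellRef L (z 0)) :=
    (((measurable_cellRef L).comp (measurable_pi_apply 0)).const_mul _).ennreal_ofReal
  have hFz : Measurable fun z : Config 1 (Fin 3) V3 => ENNReal.ofReal (F (z 0).2) :=
    (hFm.comp ((measurable_pi_apply 0).snd)).ennreal_ofReal
  rw [cellLaw_one_eq σ hL Φ, lintegral_withDensity_eq_lintegral_mul _ hdens hFz]
  -- transport `Config 1 ≃ V3 × V3`
  have hmp := volume_preserving_funUnique (Fin 1) (V3 × V3)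
  have step1 : ∫⁻ z : Config 1 (Fin 3) V3, ((fun z : Config 1 (Fin 3) V3 =>
      ENNReal.ofReal ((L ^ 3)⁻¹ * cellRef L (z 0))) * fun z : Config 1 (Fin 3) V3 =>
        ENNReal.ofReal (F (z 0).2)) z =
      ∫⁻ p : V3 × V3, ENNReal.ofReal ((L ^ 3)⁻¹ * cellRef L p) * ENNReal.ofReal (F p.2) := by
    rw [← hmp.lintegral_comp_emb (MeasurableEquiv.measurableEmbedding _)]
    rfl
  rw [step1]
  -- split the integrand as (function of x) * (function of v)
  have step2 : ∀ p : V3 × V3, ENNReal.ofReal ((L ^ 3)⁻¹ * cellRef L p) * ENNReal.ofReal (F p.2) =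
      (cellCube L).indicator (fun _ => (1 : ℝ≥0∞)) p.1 *
        ENNReal.ofReal ((L ^ 3)⁻¹ * (globalMaxwellian p.2 * F p.2)) := by
    rintro ⟨x, v⟩
    by_cases hx : x ∈ cellCube L
    · simp only [cellRef, cellCube] at hx ⊢
      rw [indicator_of_mem hx, indicator_of_mem hx, one_mul, one_mul,
        ← ENNReal.ofReal_mul (mul_nonneg (inv_nonneg.2 hL3.le) (globalMaxwellian_pos _).le)]
      ring_nf
    · simp only [cellRef, cellCube] at hx ⊢
      rw [indicator_of_notMem hx, indicator_of_notMem hx]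
      simp
  simp_rw [step2]
  have hf1 : Measurable fun x : V3 => (cellCube L).indicator (fun _ => (1 : ℝ≥0∞)) x :=
    measurable_const.indicator (measurableSet_cellCube L)
  have hf2 : Measurable fun v : V3 => ENNReal.ofReal ((L ^ 3)⁻¹ * (globalMaxwellian v * F v)) :=
    ((continuous_globalMaxwellian.measurable.mul hFm).const_mul _).ennreal_ofReal
  rw [Measure.volume_eq_prod, lintegral_prod_mul hf1.aemeasurable hf2.aemeasurable,
    lintegral_indicator_const (measurableSet_cellCube L), one_mul, volume_cellCube,
    ← ofReal_integral_eq_lintegral_ofReal (hFi.const_mul _)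
      (Eventually.of_forall fun v => by
        exact mul_nonneg (inv_nonneg.2 hL3.le) (mul_nonneg (globalMaxwellian_pos v).le (hF0 v))),
    integral_const_mul, ← ENNReal.ofReal_pow hL.le, ← ENNReal.ofReal_mul (by positivity),
    ← mul_assoc, mul_inv_cancel₀ hL3.ne', one_mul]

end CellForecastPressureDecay

end

end Summit.AtomisticToContinuum.HydrodynamicLimit.Theorems
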